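import Summits.HodgeConjecture.CorCM.Census.BlockParityLaw

/-!
# The block-parity law, VI: counting the blocks — Burnside for base change, `β(G,c)·|G| = Σ_{g : c ∉ ⟨g⟩} 2^{|G|/(2·ord g)}`, and `|CM types| = 2^{|G|/2}`

COR-CM (cell `pub-hodgecm2`), count-neutral kernel combinatorics by the binder seat b09 (gen 28; lane BLOCK-PARITY-FLOOR),
part VI, sequel of `Census/BlockParityLaw.lean` (I) only.  Theorems + three bookkeeping definitions (`Sec`, the sections of an
involution; `pairSetoid`; `rtAction`, the base change as a Mathlib `MulAction` — a `def` used locally, NOT a global instance on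
`CMF G c`); Mathlib's Burnside lemma `MulAction.sum_card_fixedBy_eq_card_orbits_mul_card_group`; no certificate, no named
fact, no `sorry`.  HONEST FRAMING: `HC_CM` is NOT proved; nothing here is a period or a headline.

CONTENT (`G` finite, `c` a central involution `≠ 1`).
* §1 **Sections of a free involution**: for a finite type `X` and `τ : X → X` with `τ ∘ τ = id`, `τ x ≠ x`, the sections
  `Sec τ = {S ⊆ X | x ∈ S ↔ τ x ∉ S}` number `2^{|X|/2}` and `|X|` is even (`card_sec`, `two_mul_card_pairs`); in particular
  (`τ = (c · )` on `G`) **`|CMF G c| = 2^{|G|/2}`** (`card_CMF`) — the `2^n` CM types of a Galois CM field of degree `2n`.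
* §2 **Fixed points of a base change** `Ψ ↦ Ψ·g⁻¹`: none if `c ∈ ⟨g⟩` (`not_rt_eq_of_mem_zpowers`); otherwise `Ψ` is fixed iff
  it is a union of left cosets of `⟨g⟩`, i.e. comes from a section of the free involution `c·` on `G ⧸ ⟨g⟩`, so there are
  `2^{|G|/(2·ord g)}` of them (`card_fixed_eq_pow`).
* §3 **Burnside** (`card_block_mul_card`): `β(G,c) · |G| = Σ_{g ∈ G} [c ∉ ⟨g⟩] · 2^{|G|/ord g/2}` — the number of blocks
  (= isogeny classes of simple CM abelian varieties split by `F` [cite: Milne1999, Prop. 2.1, p. 54]) of EVERY Galois CM type as a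
  sum over the `|G|` group elements instead of a census of the `2^{|G|/2}` types.  Cyclic: `β(ℤ/2m)·2m = Σ_{d | m, d odd} φ(d) 2^{m/d}`
  (`β = 2, 2, 4, 6, 10, 16, 30, 52, 94, 172, 316` for `2m = 6 … 26`; with part V's `δ = 0` the law reads
  `μ(ℤ/2m) ≥ β − 1 = 1, 1, 3, 5, 9, 15, 29, 51, 93, 171, 315`); `ℤ/2 × ℤ/10: 56`, `D₂₀: 68`, `Dic₅: 52`, `(ℤ/2)⁴: 30`, `D₁₆: 24`,
  `Q₁₆: 16` (numerals not decided here).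

## References
* [Pohlmann1968] H. Pohlmann, Algebraic cycles on abelian varieties of complex multiplication type, Ann. of Math. 88 (1968), Thm 1.
* [Milne1999] J. S. Milne, Lefschetz motives and the Tate conjecture, Compositio Math. 117 (1999), Prop. 2.1, p. 54.
-/

namespace Summit.HodgeConjecture.CorCM.Census.BlockParity

open Finset
open Summit.HodgeConjecture.CorCM.Prior.AllgGroup.RfwfAllgGroup

noncomputable section

/-! ## §1 Sections of a free involution -/

section Sections

variable {X : Type*} [Fintype X] [DecidableEq X] (τ : X → X)

/-- **Sections** of an involution `τ`: subsets containing exactly one of `x, τ x` for every `x`. [folklore] -/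
abbrev Sec : Type _ := {S : Finset X // ∀ x : X, x ∈ S ↔ τ x ∉ S}

/-- The orbit relation `x ~ y ⟺ y = x ∨ y = τ x` of an involution. [folklore] -/
def pairSetoid (hτ : ∀ x, τ (τ x) = x) : Setoid X where
  r x y := y = x ∨ y = τ x
  iseqv :=
    ⟨fun _ => Or.inl rfl,
      fun {x y} h => by
        rcases h with rfl | rfl
        · exact Or.inl rfl
        · exact Or.inr (hτ x).symm,
      fun {x y z} h h' => by
        rcases h with rfl | rfl
        · exact h'
        · rcases h' with rfl | rfl
          · exact Or.inr rfl
          · exact Or.inl (hτ x)⟩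

/-- The pairs form a finite type. [folklore] -/
instance fintypeQuotientPairSetoid (hτ : ∀ x, τ (τ x) = x) : Fintype (Quotient (pairSetoid τ hτ)) := Fintype.ofFinite _

omit [Fintype X] [DecidableEq X] in
/-- The representative of the pair of `x` is `x` or `τ x`. [folklore] -/
theorem out_mk_eq (hτ : ∀ x, τ (τ x) = x) (x : X) :
    (Quotient.mk (pairSetoid τ hτ) x).out = x ∨ (Quotient.mk (pairSetoid τ hτ) x).out = τ x := by
  have h : x = (Quotient.mk (pairSetoid τ hτ) x).out ∨ x = τ (Quotient.mk (pairSetoid τ hτ) x).out :=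
    Quotient.exact (Quotient.out_eq (Quotient.mk (pairSetoid τ hτ) x))
  rcases h with h | h
  · exact Or.inl h.symm
  · exact Or.inr ((congrArg τ h).trans (hτ _)).symm

omit [Fintype X] [DecidableEq X] in
/-- `τ x` lies in the pair of `x`. [folklore] -/
theorem mk_apply_eq (hτ : ∀ x, τ (τ x) = x) (x : X) :
    Quotient.mk (pairSetoid τ hτ) (τ x) = Quotient.mk (pairSetoid τ hτ) x :=
  Quotient.sound (Or.inr (hτ x).symm : x = τ x ∨ x = τ (τ x))

/-- **`|X| = 2 · #pairs`** for a fixed-point-free involution. [folklore] -/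
theorem two_mul_card_pairs (hτ : ∀ x, τ (τ x) = x) (hτ1 : ∀ x, τ x ≠ x) :
    2 * Fintype.card (Quotient (pairSetoid τ hτ)) = Fintype.card X := by
  classical
  rw [mul_comm, ← Fintype.card_bool, ← Fintype.card_prod]
  refine (Fintype.card_congr ?_).symm
  refine
    { toFun := fun x => (Quotient.mk (pairSetoid τ hτ) x, decide (x = (Quotient.mk (pairSetoid τ hτ) x).out))
      invFun := fun p => if p.2 = true then p.1.out else τ p.1.out
      left_inv := fun x => ?_
      right_inv := fun p => ?_ }
  · rcases out_mk_eq τ hτ x with h | h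
    · simp [h]
    · have hne : x ≠ τ x := fun e => hτ1 x e.symm
      simp [hne, h, hτ]
  · obtain ⟨q, b⟩ := p
    induction q using Quotient.inductionOn with
    | h y =>
      have hmkτ : Quotient.mk (pairSetoid τ hτ) (τ (Quotient.mk (pairSetoid τ hτ) y).out) =
          Quotient.mk (pairSetoid τ hτ) y := by
        rw [mk_apply_eq, Quotient.out_eq]
      cases b
      · simp only [Bool.false_eq_true, if_false, Prod.mk.injEq]
        refine ⟨hmkτ, ?_⟩
        rw [hmkτ, decide_eq_false_iff_not]
        exact hτ1 _
      · simp

/-- **Sections ↔ subsets of the pairs**: `#Sec τ = 2^{#pairs}`. [folklore] -/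
theorem card_sec_eq_two_pow (hτ : ∀ x, τ (τ x) = x) (hτ1 : ∀ x, τ x ≠ x) :
    Fintype.card (Sec τ) = 2 ^ Fintype.card (Quotient (pairSetoid τ hτ)) := by
  classical
  rw [← Fintype.card_bool, ← Fintype.card_fun]
  refine Fintype.card_congr ?_
  refine
    { toFun := fun S o => decide (o.out ∈ S.1)
      invFun := fun f => ⟨Finset.univ.filter fun x =>
          if x = (Quotient.mk (pairSetoid τ hτ) x).out then f (Quotient.mk (pairSetoid τ hτ) x) = true
          else f (Quotient.mk (pairSetoid τ hτ) x) = false, ?_⟩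
      left_inv := fun S => ?_
      right_inv := fun f => ?_ }
  · -- the filter is a section
    intro x
    simp only [Finset.mem_filter, Finset.mem_univ, true_and, mk_apply_eq]
    rcases out_mk_eq τ hτ x with h | h
    · have hne : τ x ≠ (Quotient.mk (pairSetoid τ hτ) x).out := by rw [h]; exact hτ1 x
      rw [if_pos h.symm, if_neg hne]
      cases f (Quotient.mk (pairSetoid τ hτ) x) <;> simp
    · have hne : x ≠ (Quotient.mk (pairSetoid τ hτ) x).out := by rw [h]; exact (hτ1 x).symm
      rw [if_neg hne, if_pos h.symm]
      cases f (Quotient.mk (pairSetoid τ hτ) x) <;> simp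
  · -- round trip on sections
    apply Subtype.ext
    ext x
    simp only [Finset.mem_filter, Finset.mem_univ, true_and, decide_eq_true_eq, decide_eq_false_iff_not]
    rcases out_mk_eq τ hτ x with h | h
    · rw [if_pos h.symm, h]
    · have hne : x ≠ (Quotient.mk (pairSetoid τ hτ) x).out := by rw [h]; exact (hτ1 x).symm
      rw [if_neg hne, h]
      exact (S.2 x).symm
  · -- round trip on functions
    funext o
    induction o using Quotient.inductionOn with
    | h y =>
      have ho : Quotient.mk (pairSetoid τ hτ) (Quotient.mk (pairSetoid τ hτ) y).out = Quotient.mk (pairSetoid τ hτ) y :=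
        Quotient.out_eq _
      simp only [Finset.mem_filter, Finset.mem_univ, true_and, ho, if_true]
      cases f (Quotient.mk (pairSetoid τ hτ) y) <;> simp

/-- **The number of sections of a fixed-point-free involution is `2^{|X|/2}`.** [folklore] -/
theorem card_sec (hτ : ∀ x, τ (τ x) = x) (hτ1 : ∀ x, τ x ≠ x) : Fintype.card (Sec τ) = 2 ^ (Fintype.card X / 2) := by
  rw [card_sec_eq_two_pow τ hτ hτ1, ← two_mul_card_pairs τ hτ hτ1]
  congr 1
  omega

end Sections

variable {G : Type*} [Group G] [Fintype G] [DecidableEq G] (c : G)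

/-- **The number of CM types of `(G, c)` is `2^{|G|/2}`** (`c` an involution `≠ 1`). [folklore] -/
theorem card_CMF (hc2 : c * c = 1) (hc1 : c ≠ 1) : Nat.card (CMF G c) = 2 ^ (Fintype.card G / 2) := by
  rw [← card_sec (fun x : G => c * x) (fun x => cmul_cmul c hc2 x) (fun x h => hc1 (by simpa using h)),
    ← Nat.card_eq_fintype_card]
  rfl

/-! ## §2 Fixed points of a base change -/

/-- The base change as a Mathlib `MulAction` (a definition used locally; not an instance). [folklore] -/
@[reducible] def rtAction : MulAction G (CMF G c) where
  smul Q Ψ := rt c Q Ψ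
  one_smul Ψ := rt_one c Ψ
  mul_smul Q Q' Ψ := rt_mul c Q Q' Ψ

/-- The stabiliser of a type under base change contains `⟨g⟩` as soon as it contains `g`. [folklore] -/
theorem rt_eq_of_mem_zpowers {g : G} {Ψ : CMF G c} (h : rt c g Ψ = Ψ) {k : G} (hk : k ∈ Subgroup.zpowers g) :
    rt c k Ψ = Ψ := by
  letI := rtAction c
  have hg : g ∈ MulAction.stabilizer G Ψ := h
  have hle : Subgroup.zpowers g ≤ MulAction.stabilizer G Ψ := Subgroup.zpowers_le.mpr hg
  exact hle hk

/-- **No fixed type when `c ∈ ⟨g⟩`** (`c` central): `Ψ·c = Ψ̄ ≠ Ψ`. [folklore] -/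
theorem not_rt_eq_of_mem_zpowers (hcen : ∀ x : G, x * c = c * x) {g : G} (hg : c ∈ Subgroup.zpowers g) (Ψ : CMF G c) :
    rt c g Ψ ≠ Ψ := by
  intro h
  have hc := rt_eq_of_mem_zpowers c h hg
  have hval := congrArg Subtype.val hc
  rw [rt_self_val c hcen Ψ] at hval
  by_cases h1 : (1 : G) ∈ Ψ.1
  · have : (1 : G) ∈ univ \ Ψ.1 := by rw [hval]; exact h1
    exact (mem_sdiff.mp this).2 h1
  · have h2 : c * 1 ∈ Ψ.1 := by by_contra hh; exact h1 ((Ψ.2 1).mpr hh)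
    have : c * 1 ∈ univ \ Ψ.1 := by rw [hval]; exact h2
    exact (mem_sdiff.mp this).2 h2

omit [Fintype G] [DecidableEq G] in
/-- `c·` is a fixed-point-free involution on `G ⧸ ⟨g⟩` when `c ∉ ⟨g⟩` (`c` central). [folklore] -/
theorem smul_quotient_ne (hc2 : c * c = 1) (hcen : ∀ x : G, x * c = c * x) {g : G} (hg : c ∉ Subgroup.zpowers g)
    (q : G ⧸ Subgroup.zpowers g) : c • q ≠ q := by
  induction q using QuotientGroup.induction_on with
  | H x =>
    intro hmem
    rw [MulAction.Quotient.smul_mk, smul_eq_mul, QuotientGroup.eq] at hmem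
    have hci : c⁻¹ = c := inv_eq_of_mul_eq_one_right hc2
    have e : (c * x)⁻¹ * x = c := by
      rw [mul_inv_rev, hci, mul_assoc, ← hcen x, ← mul_assoc, inv_mul_cancel, one_mul]
    rw [e] at hmem
    exact hg hmem

/-- A fixed type of the base change along `g` is a union of left cosets of `⟨g⟩`. [folklore] -/
theorem mem_iff_of_mk_eq {g : G} {Ψ : CMF G c} (h : rt c g Ψ = Ψ) {x y : G}
    (hxy : (QuotientGroup.mk x : G ⧸ Subgroup.zpowers g) = QuotientGroup.mk y) : x ∈ Ψ.1 ↔ y ∈ Ψ.1 := by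
  rw [QuotientGroup.eq] at hxy
  have hk := rt_eq_of_mem_zpowers c h hxy
  have e : y = x * (x⁻¹ * y) := by group
  rw [e, ← mem_rt c (x⁻¹ * y) Ψ x, hk]

/-- **Fixed types of the base change along `g`, `c ∉ ⟨g⟩`: `2^{|G|/ord g/2}` of them** (sections of `c·` on `G ⧸ ⟨g⟩`). [folklore] -/
theorem card_fixed_eq_pow (hc2 : c * c = 1) (hcen : ∀ x : G, x * c = c * x) {g : G} (hg : c ∉ Subgroup.zpowers g) :
    Nat.card {Ψ : CMF G c // rt c g Ψ = Ψ} = 2 ^ (Fintype.card G / orderOf g / 2) := by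
  classical
  haveI : Fintype (CMF G c) := Fintype.ofFinite _
  rw [Nat.card_eq_fintype_card]
  have hτ : ∀ q : G ⧸ Subgroup.zpowers g, c • (c • q) = q := fun q => by rw [smul_smul, hc2, one_smul]
  have hτ1 : ∀ q : G ⧸ Subgroup.zpowers g, c • q ≠ q := smul_quotient_ne c hc2 hcen hg
  have hcardQ : Fintype.card (G ⧸ Subgroup.zpowers g) = Fintype.card G / orderOf g := by
    have h := Subgroup.card_eq_card_quotient_mul_card_subgroup (Subgroup.zpowers g)
    rw [Nat.card_zpowers, Nat.card_eq_fintype_card, Nat.card_eq_fintype_card] at h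
    rw [h, Nat.mul_div_cancel _ (orderOf_pos g)]
  rw [← hcardQ, ← card_sec (fun q : G ⧸ Subgroup.zpowers g => c • q) hτ hτ1]
  refine Fintype.card_congr ?_
  refine
    { toFun := fun Ψ => ⟨Finset.univ.filter fun q : G ⧸ Subgroup.zpowers g => q.out ∈ Ψ.1.1, ?_⟩
      invFun := fun S => ⟨⟨Finset.univ.filter fun x : G => (QuotientGroup.mk x : G ⧸ Subgroup.zpowers g) ∈ S.1, ?_⟩, ?_⟩
      left_inv := fun Ψ => ?_
      right_inv := fun S => ?_ }
  · -- the image of a fixed type is a section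
    intro q
    induction q using QuotientGroup.induction_on with
    | H x =>
      simp only [Finset.mem_filter, Finset.mem_univ, true_and, MulAction.Quotient.smul_mk, smul_eq_mul]
      rw [mem_iff_of_mk_eq c Ψ.2 (QuotientGroup.out_eq' (QuotientGroup.mk x : G ⧸ Subgroup.zpowers g)),
        mem_iff_of_mk_eq c Ψ.2 (QuotientGroup.out_eq' (QuotientGroup.mk (c * x) : G ⧸ Subgroup.zpowers g))]
      exact Ψ.1.2 x
  · -- the preimage of a section is a CM type
    intro x
    simp only [Finset.mem_filter, Finset.mem_univ, true_and]
    rw [S.2 (QuotientGroup.mk x)]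
    dsimp only
    rw [MulAction.Quotient.smul_mk, smul_eq_mul]
  · -- … fixed by the base change along `g`
    apply Subtype.ext; ext P
    simp only [mem_rt, Finset.mem_filter, Finset.mem_univ, true_and]
    have e : (QuotientGroup.mk (P * g) : G ⧸ Subgroup.zpowers g) = QuotientGroup.mk P := by
      rw [QuotientGroup.eq]
      have : (P * g)⁻¹ * P = g⁻¹ := by group
      rw [this]
      exact Subgroup.inv_mem _ (Subgroup.mem_zpowers g)
    rw [e]
  · -- round trip on fixed types
    apply Subtype.ext; apply Subtype.ext; ext x
    simp only [Finset.mem_filter, Finset.mem_univ, true_and]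
    exact mem_iff_of_mk_eq c Ψ.2 (QuotientGroup.out_eq' (QuotientGroup.mk x : G ⧸ Subgroup.zpowers g))
  · -- round trip on sections
    apply Subtype.ext; ext q
    simp only [Finset.mem_filter, Finset.mem_univ, true_and]
    rw [QuotientGroup.out_eq']

/-! ## §3 Burnside: the number of blocks -/

/-- **THE NUMBER OF BLOCKS by Burnside**: `β(G,c) · |G| = Σ_{g} [c ∉ ⟨g⟩] · 2^{|G|/ord g/2}` for every finite group `G` with a
central involution `c ≠ 1`. [folklore] -/
theorem card_block_mul_card (hc2 : c * c = 1) (hcen : ∀ x : G, x * c = c * x) :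
    Fintype.card (Block c) * Fintype.card G =
      ∑ g : G, if c ∈ Subgroup.zpowers g then 0 else 2 ^ (Fintype.card G / orderOf g / 2) := by
  classical
  letI := rtAction c
  haveI : Fintype (CMF G c) := Fintype.ofFinite _
  have hB := MulAction.sum_card_fixedBy_eq_card_orbits_mul_card_group G (CMF G c)
  have hQ : Fintype.card (Quotient (MulAction.orbitRel G (CMF G c))) = Fintype.card (Block c) := by
    refine Fintype.card_congr (Quotient.congrRight fun Ψ Ψ' => ?_)
    rw [MulAction.orbitRel_apply, MulAction.mem_orbit_iff]
    change (∃ Q : G, rt c Q Ψ' = Ψ) ↔ ∃ Q : G, rt c Q Ψ = Ψ'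
    constructor
    · rintro ⟨Q, hQ⟩
      exact ⟨Q⁻¹, by rw [← hQ, rt_inv_rt]⟩
    · rintro ⟨Q, hQ⟩
      exact ⟨Q⁻¹, by rw [← hQ, rt_inv_rt]⟩
  rw [hQ] at hB
  rw [← hB]
  refine Finset.sum_congr rfl fun g _ => ?_
  have e : Fintype.card (MulAction.fixedBy (CMF G c) g) = Fintype.card {Ψ : CMF G c // rt c g Ψ = Ψ} :=
    Fintype.card_congr (Equiv.subtypeEquivRight fun Ψ => Iff.rfl)
  rw [e]
  split_ifs with hg
  · exact Fintype.card_eq_zero_iff.mpr ⟨fun Ψ => not_rt_eq_of_mem_zpowers c hcen hg Ψ.1 Ψ.2⟩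
  · rw [← Nat.card_eq_fintype_card]; exact card_fixed_eq_pow c hc2 hcen hg

end

end Summit.HodgeConjecture.CorCM.Census.BlockParity
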